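import Summits.ValiantsHypothesis.ValiantsHypothesis.Theorems.BarrierLeverSuccinctHittingSetsForVPSpsk
import Literature.Computability.AlgebraicComplexity.DepthThreeVariableReductionProofs

/-!
# Crux `BarrierLever.SuccinctHittingSetsForVP` (stmt-ValiantsHypothesis-14610) — the `ΣΠΣ(k)` slice
# made UNCONDITIONAL: Saxena–Seshadhri's variable reduction is now a theorem of the tree

`BarrierLeverSuccinctHittingSetsForVPSpsk.lean` proved, for `n ≥ 8` and top fan-in `k ≤ n`, that the
coefficient vectors of `SmallCircuits ℂ n 10` hit every nonzero depth-3 distinguisher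
`D = Σ_{i<k} ∏_{j<d_i} ℓ_{ij}` with affine forms `ℓ_{ij}` in the `N = C(2n,n)` coefficient variables
(`isSuccinctHittingSet_spsk`), hence that no such `ΣΠΣ(k)` polynomial is an algebraically natural
proof against `SmallCircuits ℂ n b`, `b ≥ 10` (`not_isNaturalProof_spsk`) — both under the hypothesis
`(hSS : SaxenaSeshadhri2012_lemma11)`, Saxena–Seshadhri's field-independent variable reduction
(SIAM J. Comput. 41 (2012), Lemma 11 / Theorem 2) as a named fact. That fact is now a THEOREM of the
tree, `Literature.Computability.AlgebraicComplexity.SaxenaSeshadhri2012_lemma11_holds`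
(`DepthThreeVariableReductionProofs.lean`), so both statements hold outright:

* `isSuccinctHittingSet_spsk'` — for `n ≥ 8`, `k ≤ n`: `SmallCircuits ℂ n 10` is a succinct hitting set
  for the `ΣΠΣ(k)` distinguishers (any degree, any size) in the coefficient variables;
* `not_isNaturalProof_spsk'` — for `n ≥ 8`, `k ≤ n`, `b ≥ 10`, any class `𝒟`: no `ΣΠΣ(k)` polynomial
  is a natural proof against `SmallCircuits ℂ n b`.

Honest framing. This is the (Q4) `ΣΠΣ(k)` SLICE of the rung (bounded top fan-in `k ≤ n`, regime
`d = n`), now unconditional; the rung `Theses.BarrierLever.SuccinctHittingSetsForVP` itself (hitting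
sets for the whole class `VP` of distinguishers, FSV Question 6 over `ℂ`) stays OPEN, and `VP ≠ VNP`
is not touched. No `sorry`, no named-fact hypotheses, no definitions.

References: [SaxenaSeshadhri2012] N. Saxena, C. Seshadhri, SIAM J. Comput. 41 (2012) 1285–1298,
Lemma 11, Theorem 2; [ForbesShpilkaVolk2018] §4.1, Def. 1, Cor. 22.
-/

-- layout Summits/ValiantsHypothesis/ValiantsHypothesis forces the duplicated namespace component
set_option linter.dupNamespace false

namespace Summit.ValiantsHypothesis.ValiantsHypothesis.Theorems.BarrierLever.SuccinctHittingSetsForVP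

open Literature.Barriers.ValiantsHypothesis Literature.Computability.AlgebraicComplexity MvPolynomial

/-- **`ΣΠΣ(k)` distinguishers are hit (unconditional).** For `n ≥ 8` and `k ≤ n`, the coefficient
vectors of `SmallCircuits ℂ n 10` hit every nonzero `Σ_{i<k} ∏_j ℓ_{ij}` with affine `ℓ_{ij}` in the
coefficient variables — `isSuccinctHittingSet_spsk` with its Saxena–Seshadhri hypothesis discharged
by `SaxenaSeshadhri2012_lemma11_holds`. The rung (class `VP`) stays open.
[cite: ForbesShpilkaVolk2018, Cor. 22] [cite: SaxenaSeshadhri2012, Lemma 11] -/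
theorem isSuccinctHittingSet_spsk' {n k : ℕ} (hn : 8 ≤ n) (hk : k ≤ n) :
    IsSuccinctHittingSet (degLEMonomials n) (SmallCircuits ℂ n 10)
      {D | ∃ (dd : Fin k → ℕ) (ℓ : (i : Fin k) → Fin (dd i) → MvPolynomial (degLEMonomials n) ℂ),
        (∀ i j, (ℓ i j).totalDegree ≤ 1) ∧ D = ∑ i, ∏ j, ℓ i j} :=
  isSuccinctHittingSet_spsk SaxenaSeshadhri2012_lemma11_holds hn hk

/-- **No `ΣΠΣ(k)` natural proofs against `VP` in regime `d = n` (unconditional).** For `n ≥ 8`,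
`k ≤ n`, `b ≥ 10` and any class `𝒟`, no `ΣΠΣ(k)` polynomial `Σ_{i<k} ∏_j ℓ_{ij}` (affine `ℓ_{ij}`)
in the coefficient variables is an algebraically natural proof against `SmallCircuits ℂ n b` —
`not_isNaturalProof_spsk` with its Saxena–Seshadhri hypothesis discharged by
`SaxenaSeshadhri2012_lemma11_holds`. (Q4) slice of the rung unconditional; the rung itself OPEN.
[cite: ForbesShpilkaVolk2018, Def. 1 and Cor. 22] [cite: SaxenaSeshadhri2012, Lemma 11] -/
theorem not_isNaturalProof_spsk' {n k b : ℕ} (hn : 8 ≤ n) (hk : k ≤ n) (hb : 10 ≤ b)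
    (𝒟 : Set (MvPolynomial (degLEMonomials n) ℂ))
    (dd : Fin k → ℕ) (ℓ : (i : Fin k) → Fin (dd i) → MvPolynomial (degLEMonomials n) ℂ)
    (hℓ : ∀ i j, (ℓ i j).totalDegree ≤ 1) :
    ¬ IsNaturalProof (degLEMonomials n) (SmallCircuits ℂ n b) 𝒟 (∑ i, ∏ j, ℓ i j) :=
  not_isNaturalProof_spsk SaxenaSeshadhri2012_lemma11_holds hn hk hb 𝒟 dd ℓ hℓ

end Summit.ValiantsHypothesis.ValiantsHypothesis.Theorems.BarrierLever.SuccinctHittingSetsForVP
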